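import Mathlib.RepresentationTheory.Coinvariants
import Mathlib.RepresentationTheory.Subrepresentation
import Mathlib.RepresentationTheory.Intertwining
import Mathlib.LinearAlgebra.Quotient.Basic
import Mathlib.LinearAlgebra.FreeModule.Basic
import Mathlib.LinearAlgebra.Dimension.Finrank
import Mathlib.LinearAlgebra.Dimension.StrongRankCondition
import Mathlib.Analysis.Complex.Circle
import Literature.NumberTheory.Automorphic.WhittakerModels
import Literature.NumberTheory.Automorphic.WhittakerTwistedJacquet
import Literature.NumberTheory.Automorphic.SmoothRepresentation
import Literature.NumberTheory.Automorphic.ParabolicInductionQuotientProofs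
import HarnessLib

/-!
# Co-Whittaker modules (Helm 2016; Helm–Moss 2018; after Emerton–Helm 2014)

Topic `NumberTheory/Automorphic`; namespace `Literature.NumberTheory.Automorphic`.

Let `F` be a non-archimedean local field, `G_n = GL_n(F)`, `U_n ≤ G_n` the upper unitriangular
subgroup, `A` a commutative ring (in the sources a `W(k)`-algebra, `k` algebraically closed of
characteristic `ℓ ≠ p`, often Noetherian) and `ψ : F → A` an additive character (in the sources
`ψ : F → W(k)ˣ`, "often regarded as an `A`-valued character", Helm–Moss 2018, §2), giving the
generic character `ψ(u) = ψ(u₁₂ + ⋯ + u_{n-1,n})` of `U_n`. The **`n`-th (top) derivative**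
`V ↦ V^{(n)}` "takes a smooth `A[G_n]`-module `V` to the module of `ψ`-coinvariants in `V`"
(Helm–Moss 2018, §2; Emerton–Helm 2014, §3.1: `V^{(n)} = Ψ⁻(Φ⁻)^{n-1} V`, an `A`-module).
**Definition** (Helm–Moss 2018, Def. 2.1, the equivalent form of Helm 2016, Def. 6.1 printed
there): a smooth `A[G_n]`-module `V` is **co-Whittaker** if (1) `V` is admissible, (2) `V^{(n)}`
is a free `A`-module of rank one, and (3) if `W` is a quotient of `V` with `W^{(n)} = 0` then
`W = 0`; `V` **dominates** `V'` if a surjection `V → V'` induces `V^{(n)} ≅ V'^{(n)}` (loc. cit.).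

Contents, for commutative rings `A` (coefficients), `R` (entries) and
`π : Representation A (GL (Fin n) R) V`:
* `genericChar ψ : U_n(R) →* Aˣ` for `ψ : AddChar R A` (the tree's `superdiagSum`; for `A = ℂ`,
  `ψ : AddChar R Circle` it is the tree's `whittakerChar ψ`, `genericChar_coeHom_compAddChar`);
* `derivTwist π ψ = ψ_U⁻¹ ⊗ π|_{U_n}` (the tree's `Representation.charTwist`), the coinvariant
  kernel `derivKer π ψ = V(U_n, ψ) = ⟨π(u) v - ψ(u) v⟩` (`derivKer_eq_span`) and the **top
  derivative** `topDerivative π ψ = V^{(n)} = V / V(U_n, ψ)` (Mathlib `Representation.Coinvariants`;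
  for `A = ℂ` the tree's `twistedJacquet`), functorial (`topDerivativeMap`) and right exact on
  quotients (`subsingleton_topDerivative_quotientRep_iff`: `(V/N)^{(n)} = 0 ↔ N + V(U_n, ψ) = V`);
* the predicate `IsCoWhittaker π ψ` (a `structure … : Prop` with the three printed clauses; the
  quotients `W` of `V` are the tree's `Subrepresentation.quotientRep`, `V ⧸ N`), its submodule
  form `isCoWhittaker_iff_sup`, and `IsCoWhittaker.free/finite/finrank_eq_one/nontrivial`;
* `Dominates π₁ π₂ ψ` (Helm–Moss 2018, §2), `Dominates.refl`, `dominates_iff_injective`.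

Deliberately NOT here: the **universal co-Whittaker module** `e W_n`, `W_n = c-Ind_{U_n}^{G_n} ψ`,
over a factor `e Z_n` of the integral Bernstein centre and the dominance theorem
"`e W_n ⊗_{e Z_n} A` dominates every co-Whittaker module of the block" (Helm 2016, Thm. 6.3;
Helm–Moss 2018, Thms. 2.3–2.4) — they need the centre of the category of smooth
`W(k)[G_n]`-modules, absent from the tree (`c-Ind` itself is `Representation.cIndRep`, file
`SmoothInduction`); `End_{A[G_n]}(V) = A` (Helm 2016, Prop. 6.2) and the equivalence of clause 3
with Helm's original "the `κ(𝔭)`-dual of `V ⊗ κ(𝔭)` is essentially AIG" (Helm 2016, Def. 6.1;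
Emerton–Helm 2014, §3.2), which use exactness of `V ↦ V^{(n)}` (pro-order of `U_n(F)` invertible
in `A`) and are not needed to state the notion.

Design notes. (a) Generality as in `WhittakerModels`: any commutative `A`, `R`; a topology on
`R` only where admissibility enters. (b) Admissibility is the tree's `Representation.IsAdmissible`
(smooth, `V^K` finitely generated for compact open `K`); Emerton–Helm 2014, §2.1, Def. 2.1.2 asks
`V^{H₀}` finitely generated for every open `H₀` over a Noetherian `A`, which for `GL_n(F)` (every
open subgroup contains a compact open one, `H₀ ↦ V^{H₀}` antitone) is the same when `A` is
Noetherian, the standing hypothesis of Emerton–Helm 2014, §2.1 and Helm 2016, §6. (c) "Free of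
rank one" is recorded literally as `Nonempty (V^{(n)} ≃ₗ[A] A)`; `Module.Free/Finite`,
`finrank = 1` are derived. (d) Clause 3 quantifies over subrepresentations `N` and the quotients
`V ⧸ N` (every quotient `A[G]`-module is of this form up to isomorphism); "`W^{(n)} = 0`" is
`Subsingleton`, "`W = 0`" is `N = ⊤`. (e) `n ≤ 1`: `U_n = 1`, `V^{(n)} = V`; the trivial
representation of `GL_1(R)` on `A` is co-Whittaker (checked in a scratch file), the zero
representation is not (`IsCoWhittaker.nontrivial`).

## References

* D. Helm, G. Moss, *Converse theorems and the local Langlands correspondence in families*,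
  Invent. Math. 214 (2018), §2, Def. 2.1 and the paragraph after it (arXiv:1610.03277, held text
  p. 5). [HelmMoss2018]
* D. Helm, *Whittaker models and the integral Bernstein center for `GL_n`*, Duke Math. J. 165
  (2016), §6: Def. 6.1, Prop. 6.2, Thm. 6.3 (arXiv:1210.1789, held text p. 12). [Helm2016]
* M. Emerton, D. Helm, *The local Langlands correspondence for `GL_n` in families*, Ann. Sci. ÉNS
  47 (2014), §2.1 (smooth/admissible over `A`), §3.1 (derivatives `V^{(r)}`). [EmertonHelm2014]
* I. N. Bernstein, A. V. Zelevinsky, Ann. Sci. ÉNS 10 (1977), §1.8 (b), 3.5, 4.3.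
  [BernsteinZelevinskyASENS1977]
-/

open Matrix

namespace Literature.NumberTheory.Automorphic

/-! ### The generic character of `U_n` with values in `Aˣ` -/

section GenericChar

variable {R : Type*} [CommRing R] {A : Type*} [CommRing A] {n : ℕ}

/-- The **generic character** `ψ_U : U_n(R) →* Aˣ`, `u ↦ ψ(u₁₂ + u₂₃ + ⋯ + u_{n-1,n})`, of an
additive character `ψ : R → A` (values are units: `ψ(x) ψ(-x) = ψ(0) = 1`), i.e. the tree's
`whittakerChar` with `ℂ` replaced by a commutative ring `A` (from `superdiagSum` and Mathlib's
`MonoidHom.toHomUnits`). (Helm–Moss 2018, §2.) [cite: HelmMoss2018, §2 (before Def. 2.1)] -/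
def genericChar (ψ : AddChar R A) : ↥(upperUnitriangular (Fin n) R) →* Aˣ :=
  MonoidHom.toHomUnits
    { toFun := fun u => ψ (superdiagSum u)
      map_one' := by rw [superdiagSum_one, AddChar.map_zero_eq_one]
      map_mul' := fun u v => by rw [superdiagSum_mul, AddChar.map_add_eq_mul] }

/-- `(genericChar ψ u : A) = ψ (u₁₂ + ⋯ + u_{n-1,n})`. [folklore] -/
@[simp] lemma coe_genericChar (ψ : AddChar R A) (u : ↥(upperUnitriangular (Fin n) R)) :
    (genericChar ψ u : A) = ψ (superdiagSum u) := rfl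

/-- **Compatibility with the complex theory**: for `ψ : R → 𝕊 ⊂ ℂ`, the generic character of the
`ℂ`-valued additive character `Circle.coeHom ∘ ψ` is the tree's `whittakerChar ψ : U_n →* ℂˣ`
(same values `ψ(u₁₂ + ⋯ + u_{n-1,n})`). [folklore] -/
lemma genericChar_coeHom_compAddChar (ψ : AddChar R Circle) :
    genericChar (n := n) (Circle.coeHom.compAddChar ψ) = whittakerChar ψ := by
  ext u
  rfl

end GenericChar

/-! ### The top derivative `V^{(n)} = V_{U_n, ψ}` -/

section Derivative

variable {R : Type*} [CommRing R] {A : Type*} [CommRing A] {n : ℕ}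
  {V : Type*} [AddCommGroup V] [Module A V]
  (π : Representation A (GL (Fin n) R) V) (ψ : AddChar R A)

/-- The **`ψ`-twisted restriction** `ψ_U⁻¹ ⊗ π|_{U_n} : u ↦ ψ_U(u)⁻¹ π(u)` (the tree's
`Representation.charTwist` for `θ = genericChar ψ`; over `ℂ` the tree's `whittakerTwist`); its
Mathlib coinvariants are the `ψ`-coinvariants of `π`. (Bernstein–Zelevinsky 1977, §1.8 (b).) [folklore] -/
abbrev derivTwist : Representation A ↥(upperUnitriangular (Fin n) R) V :=
  π.charTwist (upperUnitriangular (Fin n) R) (genericChar ψ)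

/-- `derivTwist π ψ u v = ψ_U(u)⁻¹ • π(u) v`. [folklore] -/
lemma derivTwist_apply (u : ↥(upperUnitriangular (Fin n) R)) (v : V) :
    derivTwist π ψ u v = ((genericChar ψ u)⁻¹ : Aˣ) • π (u : GL (Fin n) R) v := rfl

/-- Over `ℂ`, `derivTwist π (Circle.coeHom ∘ ψ)` is the tree's `whittakerTwist π ψ`. [folklore] -/
lemma derivTwist_coeHom_compAddChar {W : Type*} [AddCommGroup W] [Module ℂ W]
    (τ : Representation ℂ (GL (Fin n) R) W) (ψ' : AddChar R Circle) :
    derivTwist τ (Circle.coeHom.compAddChar ψ') = whittakerTwist τ ψ' := by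
  rw [derivTwist, genericChar_coeHom_compAddChar]

/-- The **coinvariant kernel** `V(U_n, ψ) ≤ V` of the top derivative: the kernel of
`V → V^{(n)}`, spanned by the `π(u) v - ψ_U(u) v` (`derivKer_eq_span`).
(Bernstein–Zelevinsky 1977, §1.8 (b): `V(U, θ)`; Emerton–Helm 2014, §3.1.) [folklore] -/
abbrev derivKer : Submodule A V := Representation.Coinvariants.ker (derivTwist π ψ)

/-- The **top derivative** (`n`-th derivative, module of `ψ`-coinvariants)
`V^{(n)} = V_{U_n,ψ} = V / V(U_n, ψ)` of a representation of `GL_n(R)` on an `A`-module `V`: an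
`A`-module (Mathlib `Representation.Coinvariants` of `derivTwist π ψ`). "The `n`-th derivative
functor `V ↦ V^{(n)}` … takes a smooth `A[G_n]`-module `V` to the module of `ψ`-coinvariants in
`V`" (Helm–Moss 2018, §2); `V^{(n)} = Ψ⁻(Φ⁻)^{n-1} V` (Emerton–Helm 2014, §3.1; Bernstein–Zelevinsky
1977, 3.5, 4.3). For `A = ℂ` this is the tree's `twistedJacquet` (via `derivTwist_coeHom_compAddChar`).
[cite: HelmMoss2018, §2 (before Def. 2.1)] -/
abbrev topDerivative : Type _ := (derivTwist π ψ).Coinvariants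

/-- The generators `π(u) v - ψ_U(u) v` lie in `V(U_n, ψ)`. [folklore] -/
lemma sub_smul_mem_derivKer (u : ↥(upperUnitriangular (Fin n) R)) (v : V) :
    π (u : GL (Fin n) R) v - ψ (superdiagSum u) • v ∈ derivKer π ψ := by
  have h := Representation.sub_smul_mem_ker_charTwist π (upperUnitriangular (Fin n) R)
    (genericChar ψ) u v
  rwa [Units.smul_def, coe_genericChar] at h

/-- **`V(U_n, ψ)` is spanned by the `π(u) v - ψ_U(u) v`** (Bernstein–Zelevinsky 1977, §1.8 (b);
Emerton–Helm 2014, §3.1: `V_ψ` is the largest quotient on which `N` acts by `ψ`).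
[cite: BernsteinZelevinskyASENS1977, §1.8 (b)] -/
theorem derivKer_eq_span :
    derivKer π ψ = Submodule.span A (Set.range fun p : ↥(upperUnitriangular (Fin n) R) × V =>
      π (p.1 : GL (Fin n) R) p.2 - ψ (superdiagSum p.1) • p.2) := by
  rw [derivKer, Representation.ker_charTwist_eq_span]
  simp only [Units.smul_def, coe_genericChar]

/-- In `V^{(n)}` the group `U_n` acts through `ψ_U`: `[π(u) v] = ψ_U(u) • [v]`. [folklore] -/
lemma coinvariantsMk_apply (u : ↥(upperUnitriangular (Fin n) R)) (v : V) :
    Representation.Coinvariants.mk (derivTwist π ψ) (π (u : GL (Fin n) R) v) =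
      ψ (superdiagSum u) • Representation.Coinvariants.mk (derivTwist π ψ) v := by
  rw [Representation.coinvariantsMk_charTwist_apply, Units.smul_def, coe_genericChar]

/-- `V^{(n)} = 0 ↔ V(U_n, ψ) = V`. [folklore] -/
lemma subsingleton_topDerivative_iff :
    Subsingleton (topDerivative π ψ) ↔ derivKer π ψ = ⊤ :=
  Submodule.Quotient.subsingleton_iff

end Derivative

/-! ### Functoriality and right exactness of `V ↦ V^{(n)}` -/

section Functorial

variable {R : Type*} [CommRing R] {A : Type*} [CommRing A] {n : ℕ}
  {V₁ : Type*} [AddCommGroup V₁] [Module A V₁] {V₂ : Type*} [AddCommGroup V₂] [Module A V₂]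
  {V₃ : Type*} [AddCommGroup V₃] [Module A V₃]
  {π₁ : Representation A (GL (Fin n) R) V₁} {π₂ : Representation A (GL (Fin n) R) V₂}
  {π₃ : Representation A (GL (Fin n) R) V₃} (ψ : AddChar R A)

/-- An intertwining map `f : π₁ → π₂` intertwines the twists `ψ_U⁻¹ ⊗ πᵢ|_{U_n}` (same linear
map). [folklore] -/
def derivTwistMap (f : π₁.IntertwiningMap π₂) :
    (derivTwist π₁ ψ).IntertwiningMap (derivTwist π₂ ψ) where
  toLinearMap := f.toLinearMap
  isIntertwining' u := LinearMap.ext fun v => by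
    simp only [LinearMap.comp_apply, Representation.charTwist_apply,
      Representation.IntertwiningMap.toLinearMap_apply, Units.smul_def, map_smul, f.isIntertwining]

/-- `derivTwistMap ψ f v = f v`. [folklore] -/
@[simp] lemma derivTwistMap_apply (f : π₁.IntertwiningMap π₂) (v : V₁) :
    derivTwistMap ψ f v = f v := rfl

/-- The map `f^{(n)} : V₁^{(n)} → V₂^{(n)}` induced by an intertwining map `f : π₁ → π₂` (the
functor `V ↦ V^{(n)}` on morphisms; Emerton–Helm 2014, §3.1; Bernstein–Zelevinsky 1977, §1.8 (b)).
[cite: EmertonHelm2014, §3.1] -/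
noncomputable def topDerivativeMap (f : π₁.IntertwiningMap π₂) :
    topDerivative π₁ ψ →ₗ[A] topDerivative π₂ ψ :=
  Representation.Coinvariants.map _ _ (derivTwistMap ψ f)

/-- `f^{(n)} [v] = [f v]`. [folklore] -/
@[simp] lemma topDerivativeMap_mk (f : π₁.IntertwiningMap π₂) (v : V₁) :
    topDerivativeMap ψ f (Representation.Coinvariants.mk _ v) =
      Representation.Coinvariants.mk _ (f v) := rfl

/-- `(id)^{(n)} = id`. [folklore] -/
@[simp] lemma topDerivativeMap_id :
    topDerivativeMap ψ (Representation.IntertwiningMap.id π₁) = LinearMap.id :=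
  Representation.Coinvariants.hom_ext (LinearMap.ext fun _ => rfl)

/-- `(g ∘ f)^{(n)} = g^{(n)} ∘ f^{(n)}`. [folklore] -/
lemma topDerivativeMap_comp (g : π₂.IntertwiningMap π₃) (f : π₁.IntertwiningMap π₂) :
    topDerivativeMap ψ (g.comp f) = topDerivativeMap ψ g ∘ₗ topDerivativeMap ψ f :=
  Representation.Coinvariants.hom_ext (LinearMap.ext fun _ => rfl)

/-- **Right exactness on objects**: a surjective intertwining map induces a surjection on top
derivatives. (Emerton–Helm 2014, §3.1, Prop. 3.1.3 (1) (arXiv: Prop. 32): the functors `Ψ⁻`, `Φ⁻`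
are exact; only the elementary half is recorded here.) [folklore] -/
theorem topDerivativeMap_surjective (f : π₁.IntertwiningMap π₂) (hf : Function.Surjective f) :
    Function.Surjective (topDerivativeMap ψ f) := by
  intro x
  obtain ⟨w, rfl⟩ := Representation.Coinvariants.mk_surjective _ x
  obtain ⟨v, rfl⟩ := hf w
  exact ⟨Representation.Coinvariants.mk _ v, rfl⟩

end Functorial

section Quotient

variable {R : Type*} [CommRing R] {A : Type*} [CommRing A] {n : ℕ}
  {V : Type*} [AddCommGroup V] [Module A V]
  (π : Representation A (GL (Fin n) R) V) (ψ : AddChar R A)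

/-- **The coinvariant kernel of a quotient is the image of the coinvariant kernel**:
`(V ⧸ N)(U_n, ψ) = (V(U_n, ψ) + N) / N`. [folklore] -/
theorem derivKer_quotientRep_eq_map (N : Subrepresentation π) :
    derivKer N.quotientRep ψ = (derivKer π ψ).map N.toSubmodule.mkQ := by
  rw [derivKer_eq_span, derivKer_eq_span, Submodule.map_span]
  congr 1
  ext w
  constructor
  · rintro ⟨⟨u, x⟩, rfl⟩
    obtain ⟨v, rfl⟩ := N.mkQ_surjective x
    refine ⟨π (u : GL (Fin n) R) v - ψ (superdiagSum u) • v, ⟨(u, v), rfl⟩, ?_⟩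
    simp only [Submodule.mkQ_apply, Submodule.Quotient.mk_sub, Submodule.Quotient.mk_smul,
      Subrepresentation.mkQ_apply, Subrepresentation.quotientRep_mk]
  · rintro ⟨_, ⟨⟨u, v⟩, rfl⟩, rfl⟩
    refine ⟨(u, N.mkQ v), ?_⟩
    simp only [Submodule.mkQ_apply, Submodule.Quotient.mk_sub, Submodule.Quotient.mk_smul,
      Subrepresentation.mkQ_apply, Subrepresentation.quotientRep_mk]

/-- **Right exactness on quotients**: for a subrepresentation `N` of `π`, the top derivative of
the quotient `V ⧸ N` vanishes iff `N + V(U_n, ψ) = V`, i.e. iff `N` surjects onto `V^{(n)}`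
(`(V ⧸ N)^{(n)} = V^{(n)} / im N^{(n)}`; Emerton–Helm 2014, §3.1). [folklore] -/
theorem subsingleton_topDerivative_quotientRep_iff (N : Subrepresentation π) :
    Subsingleton (topDerivative N.quotientRep ψ) ↔ N.toSubmodule ⊔ derivKer π ψ = ⊤ := by
  rw [subsingleton_topDerivative_iff, derivKer_quotientRep_eq_map, Submodule.map_mkQ_eq_top]

end Quotient

/-! ### Co-Whittaker modules -/

section CoWhittaker

variable {R : Type*} [CommRing R] [TopologicalSpace R] {A : Type*} [CommRing A] {n : ℕ}
  {V : Type*} [AddCommGroup V] [Module A V]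

/-- A representation `π` of `GL_n(R)` on an `A`-module `V` (a smooth `A[G_n]`-module) is
**co-Whittaker** with respect to the additive character `ψ : R → A` if
1. `V` is admissible as an `A[G_n]`-module (`Representation.IsAdmissible`: smooth, and `V^K`
   finitely generated over `A` for every compact open `K`);
2. `V^{(n)}` is a free `A`-module of rank one (`V^{(n)} ≃ₗ[A] A`);
3. if `W = V ⧸ N` is a quotient of `V` (by a subrepresentation `N`) such that `W^{(n)} = 0`,
   then `W = 0` (i.e. `N = V`).

(Helm–Moss 2018, Def. 2.1: "A smooth `A[G_n]`-module `V` is co-Whittaker if the following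
conditions hold: (1) `V` is admissible as an `A[G_n]`-module, (2) `V^{(n)}` is a free `A`-module of
rank one, and (3) if `W` is a quotient of `V` such that `W^{(n)} = 0`, then `W = 0`. (This is not
quite the definition given in [Helm 2016], but is easily seen to be equivalent …)"; Helm 2016,
Def. 6.1, whose third clause reads instead "the `κ(𝔭)`-dual of `V ⊗_A κ(𝔭)` is essentially AIG for
every prime `𝔭` of `A`", for `A` a Noetherian `W(k)`-algebra.) A DEFINITION (predicate on
`(π, ψ)`, explicit binders), not a named fact. [cite: HelmMoss2018, Def. 2.1] -/
structure IsCoWhittaker (π : Representation A (GL (Fin n) R) V) (ψ : AddChar R A) : Prop where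
  /-- (1) `V` is admissible (in particular smooth) as an `A[G_n]`-module. -/
  isAdmissible : π.IsAdmissible
  /-- (2) `V^{(n)}` is free of rank one over `A`. -/
  nonempty_linearEquiv : Nonempty (topDerivative π ψ ≃ₗ[A] A)
  /-- (3) a quotient `W = V ⧸ N` of `V` with `W^{(n)} = 0` is zero. -/
  eq_top_of_subsingleton : ∀ N : Subrepresentation π,
    Subsingleton (topDerivative N.quotientRep ψ) → N = ⊤

variable (π : Representation A (GL (Fin n) R) V) (ψ : AddChar R A)

/-- **Co-Whittaker, submodule form of clause 3**: `π` is co-Whittaker iff it is admissible,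
`V^{(n)} ≃ A`, and no proper subrepresentation `N` satisfies `N + V(U_n, ψ) = V` — every proper
quotient of `V` keeps a non-zero top derivative ("every vector is generic modulo any proper
quotient"). [folklore] -/
theorem isCoWhittaker_iff_sup :
    IsCoWhittaker π ψ ↔ π.IsAdmissible ∧ Nonempty (topDerivative π ψ ≃ₗ[A] A) ∧
      ∀ N : Subrepresentation π, N.toSubmodule ⊔ derivKer π ψ = ⊤ → N = ⊤ := by
  constructor
  · rintro ⟨h1, h2, h3⟩
    exact ⟨h1, h2, fun N hN => h3 N ((subsingleton_topDerivative_quotientRep_iff π ψ N).2 hN)⟩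
  · rintro ⟨h1, h2, h3⟩
    exact ⟨h1, h2, fun N hN => h3 N ((subsingleton_topDerivative_quotientRep_iff π ψ N).1 hN)⟩

variable {π ψ}

/-- A co-Whittaker module is smooth. [folklore] -/
lemma IsCoWhittaker.isSmooth (h : IsCoWhittaker π ψ) : π.IsSmooth := h.isAdmissible.isSmooth

/-- Clause 3 in submodule form: a subrepresentation `N` with `N + V(U_n, ψ) = V` is everything.
[folklore] -/
lemma IsCoWhittaker.eq_top_of_sup_eq_top (h : IsCoWhittaker π ψ) (N : Subrepresentation π)
    (hN : N.toSubmodule ⊔ derivKer π ψ = ⊤) : N = ⊤ :=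
  ((isCoWhittaker_iff_sup π ψ).1 h).2.2 N hN

/-- The top derivative of a co-Whittaker module is a free `A`-module. [folklore] -/
lemma IsCoWhittaker.free (h : IsCoWhittaker π ψ) : Module.Free A (topDerivative π ψ) := by
  obtain ⟨e⟩ := h.nonempty_linearEquiv
  exact Module.Free.of_equiv e.symm

/-- The top derivative of a co-Whittaker module is a finitely generated `A`-module. [folklore] -/
lemma IsCoWhittaker.finite (h : IsCoWhittaker π ψ) : Module.Finite A (topDerivative π ψ) := by
  obtain ⟨e⟩ := h.nonempty_linearEquiv
  exact Module.Finite.equiv e.symm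

/-- The top derivative of a co-Whittaker module has rank one (over a non-zero ring). [folklore] -/
lemma IsCoWhittaker.finrank_eq_one [Nontrivial A] (h : IsCoWhittaker π ψ) :
    Module.finrank A (topDerivative π ψ) = 1 := by
  obtain ⟨e⟩ := h.nonempty_linearEquiv
  rw [e.finrank_eq, Module.finrank_self]

/-- Over a non-zero ring the top derivative of a co-Whittaker module is non-zero:
`V(U_n, ψ) ≠ V`. [folklore] -/
lemma IsCoWhittaker.derivKer_ne_top [Nontrivial A] (h : IsCoWhittaker π ψ) : derivKer π ψ ≠ ⊤ := by
  obtain ⟨e⟩ := h.nonempty_linearEquiv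
  intro htop
  have hs : Subsingleton (topDerivative π ψ) := (subsingleton_topDerivative_iff π ψ).2 htop
  exact not_subsingleton A (e.symm.injective.subsingleton)

/-- Over a non-zero ring a co-Whittaker module is non-zero. [folklore] -/
lemma IsCoWhittaker.nontrivial [Nontrivial A] (h : IsCoWhittaker π ψ) : Nontrivial V := by
  by_contra hV
  rw [not_nontrivial_iff_subsingleton] at hV
  exact h.derivKer_ne_top (Subsingleton.elim _ _)

end CoWhittaker

/-! ### Dominance -/

section Dominates

variable {R : Type*} [CommRing R] {A : Type*} [CommRing A] {n : ℕ}
  {V₁ : Type*} [AddCommGroup V₁] [Module A V₁] {V₂ : Type*} [AddCommGroup V₂] [Module A V₂]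

/-- `π₁` **dominates** `π₂` (with respect to `ψ`) if there is a surjection `π₁ → π₂` of
`A[G_n]`-modules inducing an isomorphism `V₁^{(n)} ≅ V₂^{(n)}` of top derivatives.
(Helm–Moss 2018, §2, after Def. 2.1: "we say that `V` dominates `V'` if there is a surjection
`V → V'` that induces an isomorphism of `V^{(n)}` with `(V')^{(n)}`"; Helm 2016, §6 asks only for
the surjection.) Used between co-Whittaker modules, where it generates the equivalence relation
"dominated by a common co-Whittaker module". [cite: HelmMoss2018, §2 (after Def. 2.1)] -/
def Dominates (π₁ : Representation A (GL (Fin n) R) V₁) (π₂ : Representation A (GL (Fin n) R) V₂)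
    (ψ : AddChar R A) : Prop :=
  ∃ f : π₁.IntertwiningMap π₂, Function.Surjective f ∧ Function.Bijective (topDerivativeMap ψ f)

/-- Dominance is reflexive (the identity). [folklore] -/
lemma Dominates.refl (π₁ : Representation A (GL (Fin n) R) V₁) (ψ : AddChar R A) :
    Dominates π₁ π₁ ψ :=
  ⟨Representation.IntertwiningMap.id π₁, Function.surjective_id, by
    rw [topDerivativeMap_id]; exact Function.bijective_id⟩

/-- For a surjection the induced map on top derivatives is automatically surjective, so
dominance only asks for its injectivity. [folklore] -/
lemma dominates_iff_injective (π₁ : Representation A (GL (Fin n) R) V₁)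
    (π₂ : Representation A (GL (Fin n) R) V₂) (ψ : AddChar R A) :
    Dominates π₁ π₂ ψ ↔ ∃ f : π₁.IntertwiningMap π₂,
      Function.Surjective f ∧ Function.Injective (topDerivativeMap ψ f) :=
  ⟨fun ⟨f, hf, hb⟩ => ⟨f, hf, hb.1⟩,
    fun ⟨f, hf, hi⟩ => ⟨f, hf, hi, topDerivativeMap_surjective ψ f hf⟩⟩

end Dominates

end Literature.NumberTheory.Automorphic
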